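import Summits.NavierStokesRegularity.FunctionalMining.NoGo.TopEigHeatCoerciveOne
import Summits.NavierStokesRegularity.FunctionalMining.NoGo.TopEigLaminateHeatLine
import Summits.NavierStokesRegularity.FunctionalMining.StretchingLaminateWindows
import HarnessLib

/-!
# FunctionalMining / NoGo — K34a: the TWO-PARAMETER SMOOTH LAMINATE FAMILY `F′ = S·(1 + bS²)^{2/q}`
# (`S = sin 2π·`, `b > −1`): profile, derivatives, factorised heat line, pointwise Bernoulli bound

HONEST FRAMING. Search for candidate a priori estimates; no regularity claim. Nothing about
Navier–Stokes is proved or asserted in this file: it constructs ONE explicit two-parameter family of smooth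
`1`-periodic zero-mean profiles and computes, by hand-checkable calculus, the quantities that K34b
(`NoGo/TopEigHeatPoincareStrict.lean`) integrates and books against the dictionary's STATIC heat-line constant
`C_λ(q) = TopEig.topEigHeatRate q` (`TopEigHeatRate.lean`; kernel window `[0, 4π²q]`) and K6's symmetrised
`C_λ^sym(q) = topBotEigHeatRate q`. Cell `pub-nsfunc`, no-go seat (gen 46); sequel of K32
(`NoGo/TopEigHeatCoerciveOne.lean`), K33a (`NoGo/TopEigLaminateHeatLine.lean`) and K33b. [ours]

THE FAMILY. For real `q > 0` and `b > −1` put `y_b(s) := 1 + b sin²(2πs) > 0` (`famBase`) and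
`G_{q,b}(s) := sin(2πs)·y_b(s)^{2/q}` (`famG`, a `ShearProfile`: smooth since `y_b > 0`, `1`-periodic, and
`G(s + ½) = −G(s)` so `∫₀¹ G = 0`); the WITNESS PROFILE is its zero-mean periodic primitive `F_{q,b}` (`famF`,
via `LaminateWindow.primitive`/`subConst`), so that the laminate `u_F = (F(x₂), 0, 0)` (`lamU famF`) is a smooth
divergence-free zero-mean field of `T³` with `F′ = G`. The point of the exponent `2/q`:
**`|F′|^q = |S|^q·y_b²` is a trigonometric polynomial times `|S|^q`**, so every integral is a Wallis moment.
* §1 the family, positivity of the base, zero means (`integral_famG`, `integral_famF`, `hasZeroMean_lamU_famF`);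
* §2 derivatives: `famG_D` (`G′ = 2π cos·y^{2/q−1}(y + (4b/q)S²)`) and
  **`famG_DD : G″ = 4π²·S·y^{2/q−2}·P_{q,b}(S²)`**, `P_{q,b}(x) = P₀ + P₁x + P₂x²` (`famP`; coefficients `famP0/1/2`:
  `P₀ = −1 + 12b/q`, `P₁ = −2b − 16b/q + 4b²(q+4)/q²`, `P₂ = −b²(q+4)²/q²`, typed through `p = 2/q` as
  `−1 + 6pb`, `−2b(1+4p) + 2pb²(1+2p)`, `−b²(1+2p)²` so that `ring` closes `famG_DD`), hence the FACTORISED HEAT LINE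
  **`famG_line : G + tG″ = S·y^{2/q−2}·(y² + t·4π²P_{q,b}(S²))`**;
* §3 with K33a's tangent-form Bernoulli (`tangent_le_abs_rpow`, at `a = y²`) and `|S·y^{2/q−2}|^q = |S|^q y^{2−2q}`
  the `rpow` factors CANCEL: POINTWISE for every real `t` and `q ≥ 1` (`famLine_rpow_ge`)
  **`|S|^q y² + t·q·4π²·|S|^q·P_{q,b}(S²) ≤ |G + tG″|^q = |F′ + tF‴|^q`**, and at `t = 0` `|F′|^q = |S|^q y²`
  (`famG_abs_rpow`); `famF_D_apply`, `famF_DDD_apply` transport these to the witness profile `F`.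

SCOPE, EXACTLY: calculus identities and one pointwise inequality for an explicit family; no functional of the
dictionary is evaluated here (K34b does the booking). Nothing about `q < 1`. PROVENANCE / STATUS. Typed by the
no-go seat (gen 46); closed forms of `G′`, `G″` and the factorisation finite-difference-checked, `P` in both forms
exact-rational-checked (`pub-nsfunc-nogo/sieveld/lamfam/identities.py`, stdlib); farm-checked at CONCAT grade
(tree K32 ++ tree K33a ++ this body under their TREE imports: `lean check` rc 0, 0 sorries, 0 warnings; axioms
standard). STATUS: STAGED (files after K32 `NoGo.TopEigHeatCoerciveOne` and K33a `NoGo.TopEigLaminateHeatLine`,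
both in the tree, are BUILT on the farm).
FILING (prove seat g28, REQUEST #51): declarations byte-identical to the no-go seat's staged `TopEigHeatLaminateFamily.STAGING.lean` 60d73f46b6df7037; this line is the only addition.
-/

noncomputable section

open MeasureTheory Set intervalIntegral Real
open scoped ContDiff Topology

namespace Summit.NavierStokesRegularity.FunctionalMining

open Literature.Analysis Literature.Analysis.FunctionSpaces Literature.Analysis.FunctionSpaces.Torus
open TopEig PlanarTopEig StrainL4 LaminateDirection LaminateWindow

namespace TopEigLaminate

/-! ## 1. The family: base, profile, zero means, the witness primitive -/

/-- **The base `y_b(s) = 1 + b sin²(2πs)`.** [ours, bookkeeping] -/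
def famBase (b s : ℝ) : ℝ := 1 + b * sin (2 * π * s) ^ 2

/-- `y_b > 0` for `b > −1`. [ours, bookkeeping] -/
theorem famBase_pos {b : ℝ} (hb : -1 < b) (s : ℝ) : 0 < famBase b s := by
  unfold famBase
  have h1 := sin_sq_le_one (2 * π * s)
  have h2 := sq_nonneg (sin (2 * π * s))
  rcases le_or_gt 0 b with h0 | h0
  · nlinarith [mul_nonneg h0 h2]
  · nlinarith [mul_nonneg (neg_nonneg.2 h0.le) (sub_nonneg.2 h1)]

/-- `y_b(s + 1) = y_b(s)`. [ours, bookkeeping] -/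
theorem famBase_add_one (b s : ℝ) : famBase b (s + 1) = famBase b s := by
  unfold famBase; rw [mul_add, mul_one, sin_add_two_pi]

/-- `y_b(s + ½) = y_b(s)`. [ours, bookkeeping] -/
theorem famBase_add_half (b s : ℝ) : famBase b (s + 1 / 2) = famBase b s := by
  unfold famBase; rw [show 2 * π * (s + 1 / 2) = 2 * π * s + π by ring, sin_add_pi, neg_sq]

/-- `s ↦ y_b(s)` is smooth. [folklore] -/
theorem contDiff_famBase (b : ℝ) : ContDiff ℝ ∞ (famBase b) :=
  contDiff_const.add (contDiff_const.mul ((contDiff_sin.comp (contDiff_const.mul contDiff_id)).pow 2))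

/-- `y_b′(s) = 4πb sin(2πs) cos(2πs)`. [ours, bookkeeping] -/
theorem hasDerivAt_famBase (b s : ℝ) :
    HasDerivAt (famBase b) (4 * π * b * sin (2 * π * s) * cos (2 * π * s)) s := by
  have h := (((hasDerivAt_sin_two_pi_mul s).fun_pow 2).const_mul b).const_add 1
  refine h.congr_deriv ?_
  simp only [Nat.cast_ofNat, Nat.add_one_sub_one, pow_one]
  ring

/-- **The derivative profile of the family, `G_{q,b}(s) = sin(2πs)·(1 + b sin²(2πs))^{2/q}`** (`b > −1`):
smooth and `1`-periodic. [ours] -/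
def famG (q b : ℝ) (hb : -1 < b) : ShearProfile where
  toFun := fun s => sin (2 * π * s) * famBase b s ^ (2 / q)
  periodic' := fun s => by
    show sin (2 * π * (s + 1)) * famBase b (s + 1) ^ (2 / q) = sin (2 * π * s) * famBase b s ^ (2 / q)
    rw [famBase_add_one, mul_add, mul_one, sin_add_two_pi]
  contDiff' := (contDiff_sin.comp (contDiff_const.mul contDiff_id)).mul
    ((contDiff_famBase b).rpow_const_of_ne fun s => (famBase_pos hb s).ne')

variable {q b : ℝ} (hb : -1 < b)

/-- Values of `G_{q,b}`. [ours, bookkeeping] -/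
theorem famG_apply (s : ℝ) : famG q b hb s = sin (2 * π * s) * famBase b s ^ (2 / q) := rfl

/-- **`G(s + ½) = −G(s)`.** [ours, bookkeeping] -/
theorem famG_add_half (s : ℝ) : famG q b hb (s + 1 / 2) = -famG q b hb s := by
  rw [famG_apply, famG_apply, famBase_add_half, show 2 * π * (s + 1 / 2) = 2 * π * s + π by ring, sin_add_pi]
  ring

/-- **`∫₀¹ G_{q,b} = 0`** (the two half-periods cancel). [ours] -/
theorem integral_famG : ∫ s in (0 : ℝ)..1, famG q b hb s = 0 := by
  have hi : ∀ u v : ℝ, IntervalIntegrable (famG q b hb) volume u v := fun u v =>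
    (famG q b hb).continuous.intervalIntegrable u v
  rw [← integral_add_adjacent_intervals (hi 0 (1 / 2)) (hi (1 / 2) 1)]
  have h2 : ∫ s in (1 / 2 : ℝ)..1, famG q b hb s = ∫ s in (0 : ℝ)..(1 / 2), famG q b hb (s + 1 / 2) := by
    rw [intervalIntegral.integral_comp_add_right (fun s => famG q b hb s)]; norm_num
  rw [h2]
  simp only [famG_add_half, intervalIntegral.integral_neg, add_neg_cancel]

/-- The periodic primitive `∫₀ᵗ G_{q,b}`. [ours, bookkeeping] -/
def famPrim (q b : ℝ) (hb : -1 < b) : ShearProfile := primitive (famG q b hb) (integral_famG hb)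

/-- **THE WITNESS PROFILE `F_{q,b}`**: the zero-mean `1`-periodic primitive of `G_{q,b}`. [ours] -/
def famF (q b : ℝ) (hb : -1 < b) : ShearProfile :=
  subConst (famPrim q b hb) (∫ s in (0 : ℝ)..1, famPrim q b hb s)

/-- Values of `F_{q,b}`. [ours, bookkeeping] -/
theorem famF_apply (s : ℝ) : famF q b hb s = famPrim q b hb s - ∫ s in (0 : ℝ)..1, famPrim q b hb s := rfl

/-- **`F′ = G`** (pointwise). [ours] -/
theorem famF_D_apply (s : ℝ) : (famF q b hb).D s = famG q b hb s := by
  rw [ShearProfile.D_apply, show ((famF q b hb : ShearProfile) : ℝ → ℝ) =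
    fun t => famPrim q b hb t - ∫ s in (0 : ℝ)..1, famPrim q b hb s from rfl, deriv_sub_const]
  exact deriv_primitive _ _ s

/-- `deriv F = G` (as functions). [ours, bookkeeping] -/
theorem deriv_famF : deriv (famF q b hb : ℝ → ℝ) = famG q b hb := by
  funext s; have h := famF_D_apply (q := q) hb s; rwa [ShearProfile.D_apply] at h

/-- **`F‴ = G″`** (pointwise). [ours, bookkeeping] -/
theorem famF_DDD_apply (s : ℝ) : (famF q b hb).D.D.D s = (famG q b hb).D.D s := by
  simp only [ShearProfile.coe_D, deriv_famF]

/-- **`∫₀¹ F_{q,b} = 0`.** [ours] -/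
theorem integral_famF : ∫ s in (0 : ℝ)..1, famF q b hb s = 0 := by
  simp_rw [famF_apply]
  rw [intervalIntegral.integral_sub ((famPrim q b hb).continuous.intervalIntegrable 0 1)
    intervalIntegrable_const, intervalIntegral.integral_const]
  simp

/-- **The laminate `u_F = (F_{q,b}(x₂), 0, 0)` has zero mean.** [ours] -/
theorem hasZeroMean_lamU_famF : Torus.HasZeroMean (lamU (famF q b hb)) :=
  hasZeroMean_lamU _ (integral_famF hb)

/-! ## 2. Derivatives of `G_{q,b}` and the factorised heat line -/

/-- **`G′(s) = 2π cos(2πs)·y^{2/q−1}·(y + 2(2/q)b sin²(2πs))`** as a derivative. [ours] -/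
theorem hasDerivAt_famG (s : ℝ) : HasDerivAt (famG q b hb : ℝ → ℝ)
    (2 * π * cos (2 * π * s) * famBase b s ^ (2 / q - 1) *
      (famBase b s + 2 * (2 / q) * b * sin (2 * π * s) ^ 2)) s := by
  have hy := famBase_pos hb s
  have h := (hasDerivAt_sin_two_pi_mul s).fun_mul
    ((hasDerivAt_famBase b s).rpow_const (p := 2 / q) (Or.inl hy.ne'))
  refine h.congr_deriv ?_
  have e : famBase b s ^ (2 / q) = famBase b s ^ (2 / q - 1) * famBase b s := by
    conv_lhs => rw [show (2 / q : ℝ) = (2 / q - 1) + 1 by ring, rpow_add hy, rpow_one]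
  rw [e]; ring

/-- **`G′`** (pointwise). [ours] -/
theorem famG_D (s : ℝ) : (famG q b hb).D s = 2 * π * cos (2 * π * s) * famBase b s ^ (2 / q - 1) *
    (famBase b s + 2 * (2 / q) * b * sin (2 * π * s) ^ 2) := by
  rw [ShearProfile.D_apply]; exact (hasDerivAt_famG hb s).deriv

/-- Coefficient `P₀ = −1 + 12b/q` (written with `p = 2/q`: `−1 + 6pb`). [ours, bookkeeping] -/
def famP0 (q b : ℝ) : ℝ := -1 + 6 * (2 / q) * b

/-- Coefficient `P₁ = −2b − 16b/q + 4b²(q + 4)/q²` (`= −2b(1 + 4p) + 2pb²(1 + 2p)`, `p = 2/q`). [ours, bookkeeping] -/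
def famP1 (q b : ℝ) : ℝ := -2 * b * (1 + 4 * (2 / q)) + 2 * (2 / q) * b ^ 2 * (1 + 2 * (2 / q))

/-- Coefficient `P₂ = −b²(q + 4)²/q²` (`= −b²(1 + 2p)²`, `p = 2/q`). [ours, bookkeeping] -/
def famP2 (q b : ℝ) : ℝ := -(b ^ 2 * (1 + 2 * (2 / q)) ^ 2)

/-- **The quadratic `P_{q,b}(x) = P₀ + P₁x + P₂x²`.** [ours, bookkeeping] -/
def famP (q b x : ℝ) : ℝ := famP0 q b + famP1 q b * x + famP2 q b * x ^ 2

/-- **`G″(s) = 4π²·sin(2πs)·y^{2/q−2}·P_{q,b}(sin²(2πs))`** (every real `q`; at `q = 0` both sides read with `2/0 = 0`). [ours] -/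
theorem famG_DD (s : ℝ) : (famG q b hb).D.D s =
    4 * π ^ 2 * sin (2 * π * s) * famBase b s ^ (2 / q - 2) * famP q b (sin (2 * π * s) ^ 2) := by
  have hy := famBase_pos hb s
  have hS := hasDerivAt_sin_two_pi_mul s
  have hC := hasDerivAt_cos_two_pi_mul s
  have hY := hasDerivAt_famBase b s
  have h := ((hC.const_mul (2 * π)).fun_mul (hY.rpow_const (p := 2 / q - 1) (Or.inl hy.ne'))).fun_mul
    (hY.fun_add ((hS.fun_pow 2).const_mul (2 * (2 / q) * b)))
  rw [ShearProfile.D_apply, show ((famG q b hb).D : ℝ → ℝ) = fun s => 2 * π * cos (2 * π * s) *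
      famBase b s ^ (2 / q - 1) * (famBase b s + 2 * (2 / q) * b * sin (2 * π * s) ^ 2) from
      funext (famG_D hb), h.deriv]
  simp only [Nat.cast_ofNat, Nat.add_one_sub_one, pow_one]
  have e1 : famBase b s ^ (2 / q - 1 - 1) = famBase b s ^ (2 / q - 2) := by
    rw [show (2 / q - 1 - 1 : ℝ) = 2 / q - 2 by ring]
  have e2 : famBase b s ^ (2 / q - 1) = famBase b s ^ (2 / q - 2) * famBase b s := by
    conv_lhs => rw [show (2 / q - 1 : ℝ) = (2 / q - 2) + 1 by ring, rpow_add hy, rpow_one]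
  rw [e1, e2]
  unfold famP famP0 famP1 famP2 famBase
  have hsc := sin_sq_add_cos_sq (2 * π * s)
  set S := sin (2 * π * s)
  set C := cos (2 * π * s)
  set Y := (1 + b * S ^ 2) ^ (2 / q - 2)
  linear_combination (8 * π ^ 2 * b * S * Y * ((2 / q - 1) * (1 + b * S ^ 2 + 2 * (2 / q) * b * S ^ 2) +
    (1 + 2 * (2 / q)) * (1 + b * S ^ 2))) * hsc

/-- **THE FACTORISED HEAT LINE: `G + tG″ = S·y^{2/q−2}·(y² + t·4π²P_{q,b}(S²))`.** [ours] -/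
theorem famG_line (t s : ℝ) : famG q b hb s + t * (famG q b hb).D.D s =
    sin (2 * π * s) * famBase b s ^ (2 / q - 2) *
      (famBase b s ^ 2 + t * (4 * π ^ 2 * famP q b (sin (2 * π * s) ^ 2))) := by
  have e : famBase b s ^ (2 / q) = famBase b s ^ (2 / q - 2) * famBase b s ^ 2 := by
    rw [← rpow_two, ← rpow_add (famBase_pos hb s), show (2 / q - 2 + 2 : ℝ) = 2 / q by ring]
  rw [famG_DD hb, famG_apply, e]; ring

/-! ## 3. The pointwise bound along the heat line (the `rpow` factors cancel) -/

/-- **`|G|^q = |S|^q·y²`** (`q > 0`): at `t = 0` the integrand is a Wallis polynomial. [ours] -/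
theorem famG_abs_rpow (hq : 0 < q) (s : ℝ) :
    |famG q b hb s| ^ q = |sin (2 * π * s)| ^ q * famBase b s ^ 2 := by
  have hy := famBase_pos hb s
  rw [famG_apply, abs_mul, abs_of_pos (rpow_pos_of_pos hy _), mul_rpow (abs_nonneg _) (rpow_nonneg hy.le _),
    ← rpow_mul hy.le, div_mul_cancel₀ _ hq.ne', rpow_two]

/-- **POINTWISE BOUND along the heat line of the family** (`q ≥ 1`, every real `t`; `S = sin 2πs`, `y = y_b(s)`):
`|S|^q·y² + t·q·4π²·|S|^q·P_{q,b}(S²) ≤ |G(s) + tG″(s)|^q`. [ours] -/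
theorem famLine_rpow_ge (hq : 1 ≤ q) (t s : ℝ) :
    |sin (2 * π * s)| ^ q * famBase b s ^ 2 +
        t * (q * (4 * π ^ 2 * (|sin (2 * π * s)| ^ q * famP q b (sin (2 * π * s) ^ 2)))) ≤
      |famG q b hb s + t * (famG q b hb).D.D s| ^ q := by
  have hq0 : q ≠ 0 := ne_of_gt (by linarith)
  have hy := famBase_pos hb s
  set S := sin (2 * π * s) with hSdef
  set y := famBase b s with hydef
  have hY : 0 < y ^ (2 / q - 2) := rpow_pos_of_pos hy _
  have hb' := tangent_le_abs_rpow (P := y ^ 2 + t * (4 * π ^ 2 * famP q b (S ^ 2))) (sq_nonneg y) hq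
  have hm := mul_le_mul_of_nonneg_left hb' (rpow_nonneg (abs_nonneg (S * y ^ (2 / q - 2))) q)
  rw [← mul_rpow (abs_nonneg _) (abs_nonneg _), ← abs_mul, ← famG_line hb t s] at hm
  refine le_trans (le_of_eq ?_) hm
  have eabs : |S * y ^ (2 / q - 2)| ^ q = |S| ^ q * y ^ (2 - 2 * q) := by
    rw [abs_mul, abs_of_pos hY, mul_rpow (abs_nonneg S) hY.le, ← rpow_mul hy.le]
    rw [show (2 / q - 2) * q = 2 - 2 * q by rw [sub_mul, div_mul_cancel₀ (2:ℝ) hq0]]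
  have e1 : (y ^ 2) ^ q = y ^ (2 * q) := by rw [← rpow_two, ← rpow_mul hy.le]
  have e2 : (y ^ 2) ^ (q - 1) = y ^ (2 * (q - 1)) := by rw [← rpow_two, ← rpow_mul hy.le]
  have eA : y ^ (2 - 2 * q) * y ^ (2 * q) = y ^ 2 := by
    rw [← rpow_add hy, show (2 - 2 * q + 2 * q : ℝ) = 2 by ring, rpow_two]
  have eB : y ^ (2 - 2 * q) * y ^ (2 * (q - 1)) = 1 := by
    rw [← rpow_add hy, show (2 - 2 * q + 2 * (q - 1) : ℝ) = 0 by ring, rpow_zero]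
  rw [eabs, e1, e2, show y ^ 2 + t * (4 * π ^ 2 * famP q b (S ^ 2)) - y ^ 2 = t * (4 * π ^ 2 * famP q b (S ^ 2))
    by ring, show |S| ^ q * y ^ (2 - 2 * q) * (y ^ (2 * q) + q * y ^ (2 * (q - 1)) *
    (t * (4 * π ^ 2 * famP q b (S ^ 2)))) = |S| ^ q * (y ^ (2 - 2 * q) * y ^ (2 * q)) +
    t * (q * (4 * π ^ 2 * (|S| ^ q * famP q b (S ^ 2)))) * (y ^ (2 - 2 * q) * y ^ (2 * (q - 1))) by ring,
    eA, eB, mul_one]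

/-- **The same bound for the witness profile: `… ≤ |F′(s) + tF‴(s)|^q`** (`q ≥ 1`). [ours] -/
theorem famF_line_rpow_ge (hq : 1 ≤ q) (t s : ℝ) :
    |sin (2 * π * s)| ^ q * famBase b s ^ 2 +
        t * (q * (4 * π ^ 2 * (|sin (2 * π * s)| ^ q * famP q b (sin (2 * π * s) ^ 2)))) ≤
      |(famF q b hb).D s + t * (famF q b hb).D.D.D s| ^ q := by
  rw [famF_D_apply, famF_DDD_apply]; exact famLine_rpow_ge hb hq t s

/-- **At `t = 0`: `|F′(s) + 0·F‴(s)|^q = |S|^q·y²`** (`q > 0`). [ours, bookkeeping] -/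
theorem famF_abs_rpow_zero (hq : 0 < q) (s : ℝ) :
    |(famF q b hb).D s + 0 * (famF q b hb).D.D.D s| ^ q = |sin (2 * π * s)| ^ q * famBase b s ^ 2 := by
  rw [zero_mul, add_zero, famF_D_apply, famG_abs_rpow hb hq]

end TopEigLaminate

end Summit.NavierStokesRegularity.FunctionalMining

end
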